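import Summits.AnomalousDissipation.AnomalousDissipation.Theorems.EnsembleRigidityGPStatisticalRigidityGpSmallEnergy
import Summits.AnomalousDissipation.AnomalousDissipation.Theorems.EnsembleRigidityGPStatisticalRigidityPartial
import Summits.AnomalousDissipation.AnomalousDissipation.Theorems.EnsembleRigidityGPMeanBoundedFamilyStubHeadModes
import Summits.AnomalousDissipation.AnomalousDissipation.Theorems.EnsembleRigidityGPMeanBoundedFamilyStubHeadCoefficients
import Summits.AnomalousDissipation.AnomalousDissipation.Theorems.LightSteadyStatesGP.Negative.TrivialWitnesses
import Literature.Analysis.FluidPDE.StokesTorusProofs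
import Literature.Analysis.FunctionSpaces.TorusCalculusProofs
import HarnessLib

/-!
# Stub `stub_gpEnergyField` of line `Sketch` (crux stmt-AnomalousDissipation-17938,
# `EnsembleRigidity.GPTameDefectFloor`) — THE TWO-SHELL ENERGY CERTIFICATE FIELD

The explicit two-shell test field `w = f_GP + (7/20)·g` of the energy axis of the line, where
`f_GP = gpForce = (sin 2πx₂, sin 2πx₀, sin 2πx₁)` is the Galloway–Proctor force and
`g = lambMode = (f_GP·∇)f_GP/(2π) = (sin2πx₁ cos2πx₂, sin2πx₂ cos2πx₀, sin2πx₀ cos2πx₁)` its Lamb mode: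

* `w` is smooth, solenoidal and mean-free (both summands are: `gpForce_admissible`,
  `lambMode_admissible`; the three properties are stable under `+` and constant multiples);
* `(f_GP, w) = ∫⟪f_GP, f_GP⟫ + (7/20) ∫⟪f_GP, g⟫ = 3/2 + 0` — the Lamb mode lives on the Fourier shell
  `|k|² = 2`, `L²`-orthogonal to the shell `|k|² = 1` of `f_GP` (`integral_inner_gpForce_lambMode`);
* the ENERGY FORM BOUND `∫ (v ⊗ v) : ∇w ≥ −(143/100)π ‖v‖²` on `H`: with `cⱼ + i sⱼ = e(xⱼ)` the
  pointwise pairing is `⟪∇w(x) u, u⟫ = 2π (a u₀u₁ + b u₀u₂ + c u₁u₂)`,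
  `a = c₀ + (7/20)(c₁c₂ − s₀s₂)`, `b = c₂ + (7/20)(c₀c₁ − s₁s₂)`, `c = c₁ + (7/20)(c₀c₂ − s₀s₁)`
  (`energyField_inner_fderiv_apply`, from the derivative of a sine Stokes mode
  `D(sin(2πk·x) a) u = 2π (k·u) cos(2πk·x) a`), and the hypothesis of the stub (the pointwise
  polynomial bound of the neighbouring stub `stub_gpEnergyPointwise`, instantiated at the angles
  `X, Y, Z = arg e(x₀), arg e(x₁), arg e(x₂)`) gives `⟪∇w(x) u, u⟫ ≥ −(143/100)π |u|²`, which is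
  integrated over `T³` exactly as in `gpForce_inertialPairing_ge`.

## References

* C. Foias, O. Manley, R. Rosa, R. Temam, *Navier–Stokes Equations and Turbulence* (CUP 2001),
  Ch. IV §1.1–1.2 (the trilinear form and the generator pairing).
* D. Galloway, M. Proctor, Nature 356 (1992) (the force).
-/

-- `Summit.<Summit>.<Problem>` is the tree's mandated summit-side namespace (CONVENTIONS §2); single-conjunct summit, duplicate deliberate.
set_option linter.dupNamespace false

noncomputable section

namespace Summit.AnomalousDissipation.AnomalousDissipation.Theorems.EnsembleRigidity.GPTameDefectFloor

open MeasureTheory Filter Topology UnitAddTorus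
open scoped InnerProductSpace RealInnerProductSpace ENNReal NNReal
open Literature.Analysis.FunctionSpaces Literature.Analysis.FluidPDE
open Summit.AnomalousDissipation.AnomalousDissipation.Theorems.EnsembleRigidity
open Summit.AnomalousDissipation.AnomalousDissipation.Theorems.EnsembleRigidity.GPMeanBoundedFamily.StubHeadModes
  (lambMode_admissible)

/-- Local notation: real vector fields on `T³`. -/
local notation "Vec3" => (UnitAddTorus (Fin 3)) → (EuclideanSpace ℝ (Fin 3))
/-- Local notation: `L²(T³; ℝ³)`. -/
local notation "L2" => (Lp (EuclideanSpace ℝ (Fin 3)) 2 (volume : Measure (UnitAddTorus (Fin 3))))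
/-- Local notation: the energy space `H`. -/
local notation "H3" => (Torus.energySpace (Fin 3))

/-! ## Admissibility of the two-shell field -/

/-- `w = f_GP + (7/20)·g` is smooth. [folklore] -/
theorem energyField_isSmooth : Torus.IsSmooth (gpForce + (7 / 20 : ℝ) • lambMode) :=
  GPStatisticalRigidity.gpForce_isSmooth.add (lambMode_admissible.1.smul (7 / 20))

/-- `w = f_GP + (7/20)·g` is divergence free. [folklore] -/
theorem energyField_isDivFree : Torus.IsDivFree (gpForce + (7 / 20 : ℝ) • lambMode) := by
  obtain ⟨hgs, hgd, -⟩ := lambMode_admissible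
  obtain ⟨hfs, hfd, -⟩ := GPStatisticalRigidity.gpForce_admissible
  exact SteadyStatesLoudBounded.GpAdmissible.isDivFree_add hfs (hgs.smul (7 / 20)) hfd
    (Torus.isDivFree_const_smul (hgs.isContDiff (by simp)) hgd (7 / 20))

/-- `w = f_GP + (7/20)·g` has zero mean. [folklore] -/
theorem energyField_hasZeroMean : Torus.HasZeroMean (gpForce + (7 / 20 : ℝ) • lambMode) := by
  obtain ⟨hgs, -, hgz⟩ := lambMode_admissible
  obtain ⟨hfs, -, hfz⟩ := GPStatisticalRigidity.gpForce_admissible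
  exact SteadyStatesLoudBounded.GpAdmissible.hasZeroMean_add hfs (hgs.smul (7 / 20)) hfz
    (Torus.hasZeroMean_const_smul hgz (7 / 20))

/-! ## The level `(f_GP, w) = 3/2` -/

/-- **The level of the certificate**: `(f_GP, w) = ∫⟪f_GP, f_GP⟫ + (7/20)∫⟪f_GP, g⟫ = 3/2 + 0` (the two
shells `|k|² = 1` of `f_GP` and `|k|² = 2` of `g` are `L²`-orthogonal: the landed
`TrivialWitnesses.integral_inner_gpForce_lambMode`). [folklore] -/
theorem energyField_integral_inner_gpForce :
    ∫ x : UnitAddTorus (Fin 3), ⟪gpForce x, (gpForce + (7 / 20 : ℝ) • lambMode) x⟫_ℝ = 3 / 2 := by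
  have hf : Continuous gpForce := GPStatisticalRigidity.gpForce_isSmooth.continuous
  have hg : Continuous lambMode := lambMode_admissible.1.continuous
  have h1 : Integrable (fun x : UnitAddTorus (Fin 3) => ⟪gpForce x, gpForce x⟫_ℝ) volume :=
    (hf.inner hf).integrable_unitAddTorus
  have h2 : Integrable (fun x : UnitAddTorus (Fin 3) => (7 / 20 : ℝ) * ⟪gpForce x, lambMode x⟫_ℝ)
      volume :=
    ((hf.inner hg).const_mul _).integrable_unitAddTorus
  simp only [Pi.add_apply, Pi.smul_apply, inner_add_right, real_inner_smul_right]
  rw [integral_add h1 h2, integral_const_mul, GPStatisticalRigidity.gpForce_integral_inner_self,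
    LightSteadyStatesGP.Negative.TrivialWitnesses.integral_inner_gpForce_lambMode, mul_zero, add_zero]

/-! ## The pointwise pairing `⟪∇w(x) u, u⟫` -/

/-- `D(sin(2π k·x) a)(x) u = 2π (k·u) cos(2π k·x) a` for a sine Stokes mode. [folklore] -/
theorem energyField_fderiv_stokesMode_sin (k : Fin 3 → ℤ) (a : EuclideanSpace ℝ (Fin 3))
    (x : UnitAddTorus (Fin 3)) (u : EuclideanSpace ℝ (Fin 3)) :
    Torus.fderiv (⇑(Torus.stokesMode k a false)) x u =
      (2 * Real.pi * ∑ j, (k j : ℝ) * u j) • Torus.stokesMode k a true x := by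
  have h1 : Torus.IsContDiff 1 (⇑(Torus.stokesMode k a false)) :=
    (Torus.isSmooth_stokesMode _ _ _).isContDiff (by simp)
  rw [Torus.fderiv_apply_eq_sum_partialDeriv h1]
  simp_rw [GPStatisticalRigidity.gpForce_partialDeriv_stokesMode_sin, smul_smul, ← Finset.sum_smul]
  congr 1
  rw [Finset.mul_sum]
  exact Finset.sum_congr rfl fun j _ => by ring

/-- For a unit complex number on the character circle, `cos (arg e(y)) = Re e(y)`. [folklore] -/
theorem energyField_cos_arg_fourier (y : UnitAddCircle) :
    Real.cos (Complex.arg (fourier 1 y)) = (fourier 1 y).re := by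
  rw [fourier_apply, Complex.cos_arg (Circle.coe_ne_zero _), Circle.norm_coe, div_one]

/-- For a unit complex number on the character circle, `sin (arg e(y)) = Im e(y)`. [folklore] -/
theorem energyField_sin_arg_fourier (y : UnitAddCircle) :
    Real.sin (Complex.arg (fourier 1 y)) = (fourier 1 y).im := by
  rw [fourier_apply, Complex.sin_arg, Circle.norm_coe, div_one]

/-- **The strain pairing of `f_GP`**: `⟪Df_GP(x) u, u⟫ = 2π (c₀ u₀u₁ + c₂ u₀u₂ + c₁ u₁u₂)`,
`cⱼ = cos 2πxⱼ = Re e(xⱼ)`. [folklore] -/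
theorem energyField_inner_fderiv_gpForce (x : UnitAddTorus (Fin 3)) (u : EuclideanSpace ℝ (Fin 3)) :
    ⟪Torus.fderiv gpForce x u, u⟫_ℝ =
      2 * Real.pi * ((fourier 1 (x 0)).re * (u 0 * u 1) + (fourier 1 (x 2)).re * (u 0 * u 2) +
        (fourier 1 (x 1)).re * (u 1 * u 2)) := by
  rw [GPStatisticalRigidity.gpForce_fderiv_apply]
  simp only [Torus.stokesMode_apply, inner_add_left, real_inner_smul_left,
    EuclideanSpace.inner_single_left, if_true, map_one, one_mul, UnitAddTorus.mFourier_single]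
  ring

/-- **The strain pairing of the Lamb mode**:
`⟪Dg(x) u, u⟫ = 2π ((c₁c₂ − s₀s₂) u₀u₁ + (c₀c₁ − s₁s₂) u₀u₂ + (c₀c₂ − s₀s₁) u₁u₂)`,
`cⱼ + i sⱼ = e(xⱼ)` (the six shell-2 sine modes differentiated one by one). [folklore] -/
theorem energyField_inner_fderiv_lambMode (x : UnitAddTorus (Fin 3)) (u : EuclideanSpace ℝ (Fin 3)) :
    ⟪Torus.fderiv lambMode x u, u⟫_ℝ =
      2 * Real.pi *
        (((fourier 1 (x 1)).re * (fourier 1 (x 2)).re - (fourier 1 (x 0)).im * (fourier 1 (x 2)).im) *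
              (u 0 * u 1) +
            ((fourier 1 (x 0)).re * (fourier 1 (x 1)).re - (fourier 1 (x 1)).im * (fourier 1 (x 2)).im) *
              (u 0 * u 2) +
          ((fourier 1 (x 0)).re * (fourier 1 (x 2)).re - (fourier 1 (x 0)).im * (fourier 1 (x 1)).im) *
            (u 1 * u 2)) := by
  have h : Torus.fderiv lambMode x u = Torus.convect (fun _ => u) lambMode x := rfl
  rw [h, GPMeanBoundedFamily.StubHeadCoefficients.lambMode_eq_sum,
    Torus.convect_finset_sum_smul Finset.univ (fun _ => (1 / 2 : ℝ))
      (fun i => Torus.isSmooth_stokesMode _ _ _) (fun _ => u) x]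
  simp only [Torus.convect, energyField_fderiv_stokesMode_sin]
  simp [Fin.sum_univ_six, Fin.sum_univ_three, inner_add_left, inner_smul_left, Torus.stokesMode_apply,
    EuclideanSpace.inner_single_left, UnitAddTorus.mFourier, Fin.prod_univ_three, fourier_neg,
    fourier_zero, -fourier_apply, Complex.mul_re, Complex.mul_im, Complex.conj_re, Complex.conj_im]
  ring

/-- **The strain pairing of the two-shell field**: `⟪∇w(x) u, u⟫ = 2π (a u₀u₁ + b u₀u₂ + c u₁u₂)` with
`a = c₀ + (7/20)(c₁c₂ − s₀s₂)`, `b = c₂ + (7/20)(c₀c₁ − s₁s₂)`, `c = c₁ + (7/20)(c₀c₂ − s₀s₁)`. [folklore] -/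
theorem energyField_inner_fderiv_apply (x : UnitAddTorus (Fin 3)) (u : EuclideanSpace ℝ (Fin 3)) :
    ⟪Torus.fderiv (gpForce + (7 / 20 : ℝ) • lambMode) x u, u⟫_ℝ =
      2 * Real.pi *
        (((fourier 1 (x 0)).re + 7 / 20 * ((fourier 1 (x 1)).re * (fourier 1 (x 2)).re -
              (fourier 1 (x 0)).im * (fourier 1 (x 2)).im)) * (u 0 * u 1) +
          ((fourier 1 (x 2)).re + 7 / 20 * ((fourier 1 (x 0)).re * (fourier 1 (x 1)).re -
              (fourier 1 (x 1)).im * (fourier 1 (x 2)).im)) * (u 0 * u 2) +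
          ((fourier 1 (x 1)).re + 7 / 20 * ((fourier 1 (x 0)).re * (fourier 1 (x 2)).re -
              (fourier 1 (x 0)).im * (fourier 1 (x 1)).im)) * (u 1 * u 2)) := by
  have hf1 : Torus.IsContDiff 1 gpForce := GPStatisticalRigidity.gpForce_isSmooth.isContDiff (by simp)
  have hg1 : Torus.IsContDiff 1 lambMode := lambMode_admissible.1.isContDiff (by simp)
  rw [Torus.fderiv_add hf1 (hg1.smul _), Torus.fderiv_const_smul hg1, add_apply, smul_apply,
    inner_add_left, real_inner_smul_left, energyField_inner_fderiv_gpForce,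
    energyField_inner_fderiv_lambMode]
  ring

/-- **Pointwise lower bound** `⟪∇w(x) u, u⟫ ≥ −(143/100)π |u|²`, given the polynomial bound of
`stub_gpEnergyPointwise` (instantiated at `X, Y, Z = arg e(x₀), arg e(x₁), arg e(x₂)`, `v = u`). [folklore] -/
theorem energyField_inner_fderiv_apply_ge
    (hP : ∀ X Y Z v₀ v₁ v₂ : ℝ, 0 ≤ 143 / 100 * (v₀ ^ 2 + v₁ ^ 2 + v₂ ^ 2) +
      2 * ((Real.cos X + 7 / 20 * (Real.cos Y * Real.cos Z - Real.sin X * Real.sin Z)) * (v₀ * v₁) +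
        (Real.cos Z + 7 / 20 * (Real.cos X * Real.cos Y - Real.sin Y * Real.sin Z)) * (v₀ * v₂) +
        (Real.cos Y + 7 / 20 * (Real.cos X * Real.cos Z - Real.sin X * Real.sin Y)) * (v₁ * v₂)))
    (x : UnitAddTorus (Fin 3)) (u : EuclideanSpace ℝ (Fin 3)) :
    -(143 / 100 * Real.pi * ‖u‖ ^ 2) ≤ ⟪Torus.fderiv (gpForce + (7 / 20 : ℝ) • lambMode) x u, u⟫_ℝ := by
  have h := hP (Complex.arg (fourier 1 (x 0))) (Complex.arg (fourier 1 (x 1)))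
    (Complex.arg (fourier 1 (x 2))) (u 0) (u 1) (u 2)
  simp only [energyField_cos_arg_fourier, energyField_sin_arg_fourier] at h
  have hu : ‖u‖ ^ 2 = u 0 ^ 2 + u 1 ^ 2 + u 2 ^ 2 := by
    rw [EuclideanSpace.norm_sq_eq, Fin.sum_univ_three]
    simp [sq_abs]
  rw [energyField_inner_fderiv_apply, hu]
  nlinarith [mul_nonneg Real.pi_pos.le h, Real.pi_pos]

/-! ## The energy form bound on `H` -/

/-- **The energy form bound**: `∫ (v ⊗ v) : ∇w ≥ −(143/100)π ‖v‖²` for every `v ∈ H`, given the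
pointwise polynomial bound (integrate the pointwise bound; the integrand is integrable since `∇w` is
bounded). [folklore] -/
theorem energyField_inertialPairing_ge
    (hP : ∀ X Y Z v₀ v₁ v₂ : ℝ, 0 ≤ 143 / 100 * (v₀ ^ 2 + v₁ ^ 2 + v₂ ^ 2) +
      2 * ((Real.cos X + 7 / 20 * (Real.cos Y * Real.cos Z - Real.sin X * Real.sin Z)) * (v₀ * v₁) +
        (Real.cos Z + 7 / 20 * (Real.cos X * Real.cos Y - Real.sin Y * Real.sin Z)) * (v₀ * v₂) +
        (Real.cos Y + 7 / 20 * (Real.cos X * Real.cos Z - Real.sin X * Real.sin Y)) * (v₁ * v₂)))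
    (v : H3) :
    -(143 / 100 * Real.pi * ‖v‖ ^ 2) ≤ Torus.inertialPairing (v : L2) (gpForce + (7 / 20 : ℝ) • lambMode) := by
  obtain ⟨C, _, hC⟩ := Torus.exists_sum_norm_partialDeriv_le energyField_isSmooth
  have hI := (Torus.integrable_inner_fderiv_apply_coe energyField_isSmooth hC (v : L2) (v : L2)).1
  have hn : Integrable (fun x => ‖((v : L2) : Vec3) x‖ ^ 2) volume :=
    (Lp.memLp (v : L2)).integrable_norm_pow two_ne_zero
  rw [Submodule.coe_norm, Torus.inertialPairing, ← Torus.integral_norm_sq_coe_eq, ← integral_const_mul,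
    ← integral_neg]
  exact integral_mono (hn.const_mul _).neg hI fun x => energyField_inner_fderiv_apply_ge hP x _

/-! ## The stub -/

/-- **Stub `stub_gpEnergyField`** (energy axis, the field). Given the pointwise bound of
`stub_gpEnergyPointwise`, the explicit two-shell field `w = f_GP + (7/20)·lambMode` is smooth,
solenoidal and mean-free, has `(f_GP, w) = 3/2` (the Lamb mode lives on the shell `|k|² = 2`,
orthogonal to `f_GP`), and satisfies the ENERGY form bound `∫ (v ⊗ v) : ∇w ≥ −(143/100)π ‖v‖²` on
`H` (pointwise `⟪∇w(x) u, u⟫ = 2π(a u₀u₁ + b u₀u₂ + c u₁u₂) ≥ −(143/100)π |u|²`, integrated as in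
`gpForce_inertialPairing_ge`). With `stub_linearFloor` (`s_E = 143π/100 < 9/2`, `s_G = 0`) this
certifies the tame defect floor at EVERY energy level `E ≤ 1/3` and EVERY `G₁`. [folklore] -/
theorem stub_gpEnergyField : (∀ X Y Z v₀ v₁ v₂ : ℝ, 0 ≤ 143 / 100 * (v₀ ^ 2 + v₁ ^ 2 + v₂ ^ 2) +
      2 * ((Real.cos X + 7 / 20 * (Real.cos Y * Real.cos Z - Real.sin X * Real.sin Z)) * (v₀ * v₁) +
        (Real.cos Z + 7 / 20 * (Real.cos X * Real.cos Y - Real.sin Y * Real.sin Z)) * (v₀ * v₂) +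
        (Real.cos Y + 7 / 20 * (Real.cos X * Real.cos Z - Real.sin X * Real.sin Y)) * (v₁ * v₂))) → Torus.IsSmooth (gpForce + (7 / 20 : ℝ) • lambMode) ∧ Torus.IsDivFree (gpForce + (7 / 20 : ℝ) • lambMode) ∧ Torus.HasZeroMean (gpForce + (7 / 20 : ℝ) • lambMode) ∧ (∫ x, ⟪gpForce x, (gpForce + (7 / 20 : ℝ) • lambMode) x⟫_ℝ) = 3 / 2 ∧ (∀ v : H3, -(143 / 100 * Real.pi * ‖v‖ ^ 2) ≤ Torus.inertialPairing (v : L2) (gpForce + (7 / 20 : ℝ) • lambMode)) := by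
  intro hP
  exact ⟨energyField_isSmooth, energyField_isDivFree, energyField_hasZeroMean,
    energyField_integral_inner_gpForce, fun v => energyField_inertialPairing_ge hP v⟩

end Summit.AnomalousDissipation.AnomalousDissipation.Theorems.EnsembleRigidity.GPTameDefectFloor

end
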